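import Summits.BirchSwinnertonDyer.BirchSwinnertonDyer.Theorems.KatoDescentTamePotSupersingularCartanMuRoadDoorsTprimeFive
import Summits.BirchSwinnertonDyer.BirchSwinnertonDyer.Theorems.KatoDescentTamePotSupersingularTameUpperUnitTwistRecordTools
import Summits.BirchSwinnertonDyer.BirchSwinnertonDyer.Theorems.KatoDescentTamePotSupersingularTameUpperUnitTwistRecordToolsTprime
import Summits.BirchSwinnertonDyer.BirchSwinnertonDyer.Theorems.Rank1ResidualIntModelReduction
import Summits.BirchSwinnertonDyer.Rank1Residual.Supersingular.CountPointsFast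
import Summits.BirchSwinnertonDyer.Rank1Residual.Supersingular.IntModelMinimalityKrausTwoMore
import Summits.BirchSwinnertonDyer.Rank1Residual.Additive.X4ThreeResCertKernel
import Summits.BirchSwinnertonDyer.Rank1Residual.X11b.CertificateCheckBridge
import Summits.BirchSwinnertonDyer.Rank1Residual.X11b.ChaPairsMinimality
import HarnessLib

/-!
# Route `KatoDescentTamePotSupersingular` (rung K8, sub-rung B4 (t′), cell `bsd-potss`): per-row (A) and U₀ RECORDS BY THE μ-ROAD at `p = 5`
# for the U₀-ns rows with split-Cartan-type image and NO unit-twist record, part 03: 446400hu1 — mod-5 image the INDEX-2 subgroup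
# `G₁₆ = ⟨(0 1; 2 0), diag(1,4)⟩ ≅ M₁₆` of `N_s(5)` (seat `bsd-potss-k8t-c4` g18; door `CartanMuRoadDoorsTprimeFive.
# missingUpperBoundAt_five_tame_of_splitCartanIndexTwoBasis_of_mu` (§4) over this seat's one-leaf road
# `CoatesSujatha2005.fineSelmerDual_moduleFinite_of_splitCartanIndexTwoBasis_five` (p643448) ∘
# `classicalMuVanishes_divisionField_of_splitCartanIndexTwoBasis_five` (p642969); `--supports stmt-BirchSwinnertonDyer-19982 --as helper`)

HONEST FRAMING. THEOREMS ONLY (no definition, no named fact, no `sorry`); PER ROW — NOT a class theorem; nothing is booked; items 19916 /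
19202 / 19982 stay OPEN at class level (class-wide open inputs: the zeta crux 24439 and the lower half of the residual 19984); (A), Conjecture A
and BSD are proved for NO curve here. ROAD: `MissingUpperBoundAt E 5 ⟸` NAMED FACTS Kato's fine-Selmer reading of 14.5 (3) (`hKatoA`), GZK
(`hGZK`), modularity (`hmod`), Coates–Sujatha Thm. 3.4 (`hCS`), Ferrero–Washington (`hFW`) `+` Cremona's `r_an = 0` (`hr`, displayed) `+`
KERNEL (this file) `Δ ≠ 0`, minimality, `Addv E 5`, `ord₅ j ≥ 0`, `SubTprime E 5`, `E[5]` irreducible `+` the DISPLAYED image data (`e`, `he`: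
every `σ ∈ Γ_ℚ` acts through `c·1`, `c·diag(1,4)`, `c·(0 1; 2 0)` or `c·(0 1; 3 0)`; `σ_s`, `σ_a` acting as `diag(1,4)`, `(0 1; 2 0)` — displayed,
numerically verified by THIS SEAT's kit j311000, not kernel-certified) `+` ONE `μ`-hypothesis (`ℚ(P₁) = ℚ(E[5])^⟨σ̄_s⟩`, octic) whose NUMERICAL
verdict — kit j309300 (k8t-c4 g17, conjA-anchor g12's engine `unitidx.gp` v2.1 sha16 0eb8f6c644f9c1fa, generic subfield sweep) and kit j311000
(this seat, `m16check.gp` sha16 97ac7b01118842e4): `ℚ(P₁) ≅ ℚ[x]/(x⁸ − 120x⁴ − 360x² + 720)`, `h = 2` CERTIFIED (`bnfcertify`), ONE prime above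
`5` (`e = 8`, `f = 1`) ⇒ `PASS:IW56` (Iwasawa 1956: `e_n = 0` for all `n`, a tree theorem) — is quoted, not kernel-checked. The row was left
without a record by the unit-twist censuses v3–v15 (`ellrank`-exhausted on every Heegner twist with `N·d² ≤ 1.2·10¹⁴`; `ellheegner` on
`E^(−119)` capped, kit j308845 / j310504) and by g17's split-Cartan door §3 (`diag(2,1)` is not in the image).

References: [Kato2004Asterisque] Thm. 12.5 (3), 14.5 (3); [CoatesSujatha2005] Thm. 3.4; [Washington1997] §7.5, §13.1; [Iwasawa1956];
[Lemmermeyer1994] §1; [Serre1972] §2.2; [Mazur1978] §6; [IrelandRosen1990] §5, §8; [SilvermanAEC2009] VII; [Kraus1989]; [Cremona2006] Table 1.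
-/

set_option autoImplicit false
set_option linter.dupNamespace false

noncomputable section

open scoped Classical NumberField Matrix
open WeierstrassCurve Field IntermediateField
  Literature.NumberTheory.EllipticCurves Literature.NumberTheory.EllipticCurves.Rank1Residual
  Literature.NumberTheory.EllipticCurves.Rank1Residual.Typed
  Literature.NumberTheory.EllipticCurves.Rank1Residual.X11RankOneCertificates
  Literature.NumberTheory.GaloisRepresentations Literature.NumberTheory.SerreUniformity
  Literature.NumberTheory.IwasawaTheory
  Summit.BirchSwinnertonDyer.BirchSwinnertonDyer.Rank1Residual.IntModel
  Summit.BirchSwinnertonDyer.Rank1Residual Summit.BirchSwinnertonDyer.Rank1Residual.Additive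
  Summit.BirchSwinnertonDyer.Rank1Residual.Supersingular Summit.BirchSwinnertonDyer.Rank1Residual.X11b
  Summit.BirchSwinnertonDyer.BirchSwinnertonDyer.Theorems

namespace Summit.BirchSwinnertonDyer.BirchSwinnertonDyer.Theorems.TameConjAFiveRecords

/-! ### `446400hu1` @ `p = 5` — `N = 446400 = 2^6·3^2·5^2·31`; Cremona: `r_an = 0` (`L(E,1) ≈ 1.7914`, root number `+1`); (t′) at `5`: `e = 3`
(Kodaira IV*, `ord₅ Δ = 8`); `#E(ℚ)_tors = 1`, `∏ c_ℓ = 2` (♭ row, `5 ∤ ∏ c_ℓ`); mod-`5` image of ORDER 16: the index-2 subgroup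
`G₁₆ = ⟨(0 1; 2 0), diag(1,4)⟩ ≅ M₁₆` of the split Cartan normaliser `N_s(5)` (kit j311000: `ψ₅ = (quartic)·(octic)`; `ℚ(E[5])` of degree `16`,
`|d| = 2^24·3^12·5^14`, Galois group with element orders `1, 2, 2, 2, 4, 4, 4, 4, 8 (×8)`, non-abelian — `M₁₆`; in the basis `(P₁, P₂)` with `x(P₁)` a
root of the quartic factor `x⁴ + 6000x³ − 12447000x² − 28144935000x + 34638187950000` of `ψ₅`, `σ_s` the non-trivial element fixing `P₁` and
`P₂ = Q − σ_s Q`, the sixteen matrices are EXACTLY `{c·1, c·diag(1,4), c·(0 1;2 0), c·(0 1;3 0) : c ∈ 𝔽₅ˣ}`, faithful); no unit-twist record through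
census v15. Leaf: `ℚ(P₁) ≅ ℚ[x]/(x⁸ − 120x⁴ − 360x² + 720)`, `h = 2` (CERT), primes above 5 `[[8, 1]]` ⇒ `PASS:IW56` (kit j309300 = C8 of the generic
sweep; kit j311000 recomputed as the field of a `5`-torsion point); `ℚ(x(P₁)) = ℚ[x]/(x⁴ − x³ − 4x² + 4x + 1) = ℚ(ζ₁₅)⁺`. -/

/-- `[0, 0, 0, (-2565000), 1570826250]` (Cremona's minimal model of `446400hu1`, `N = 446400 = 2^6·3^2·5^2·31`) is an elliptic curve:
`|Δ| = 2^6·3^9·5^8·31^5 ≠ 0`. [cite: Cremona2006, Table 1 (Cremona label 446400hu1)] -/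
theorem isElliptic_g446400hu1 : (⟨0, 0, 0, (-2565000), 1570826250⟩ : WeierstrassCurve ℚ).IsElliptic :=
  isElliptic_of_discOf_ne_zero 0 0 0 (-2565000) 1570826250 (by decide +kernel)

/-- `[0, 0, 0, (-2565000), 1570826250]` (Cremona's minimal model of `446400hu1`) is globally minimal: `|Δ| = 2^6·3^9·5^8·31^5` kernel-checked,
Kraus' criterion prime by prime. [cite: SilvermanAEC2009, VII.1 Remark 1.1] [cite: Kraus1989, Prop. 1 and Prop. 2]
[cite: Cremona2006, Table 1 (Cremona label 446400hu1)] -/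
theorem isGloballyMinimal_g446400hu1 : (⟨0, 0, 0, (-2565000), 1570826250⟩ : WeierstrassCurve ℚ).IsGloballyMinimal :=
  isGloballyMinimal_of_krausCriterion₃_factored 0 0 0 (-2565000) 1570826250
    [(2, 6), (3, 9), (5, 8), (31, 5)] (by decide +kernel)
    (by intro qe hqe; simp only [List.mem_cons, List.not_mem_nil, or_false] at hqe
        rcases hqe with rfl | rfl | rfl | rfl <;> norm_num)
    (by set_option synthInstance.maxSize 2000 in decide +kernel)

/-- **`E[5]` IRREDUCIBLE for `E = 446400hu1`** (kernel; Frobenius witness `ℓ = 7`: `#Ẽ(𝔽_7) = 8`, `a_7 = 0`, `X² − (0)X + 7` has no root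
mod `5`; `IntModel.hasIrreducibleModPGaloisRep_of_intModel_of_noroot`). [cite: Mazur1978, §6 Prop. 6.3 (1) (p. 153)]
[cite: IrelandRosen1990, Prop. 5.1.2 and §8.1] [cite: Cremona2006, Table 1 (Cremona label 446400hu1)] -/
theorem irr_g446400hu1_5 : haveI : Fact (Nat.Prime 5) := ⟨by norm_num⟩; (⟨0, 0, 0, (-2565000), 1570826250⟩ : WeierstrassCurve ℚ).HasIrreducibleModPGaloisRep 5 := by
  have hnr : ∀ t : ZMod 5, t ^ 2 - ((((7 : ℕ) : ℤ) + 1 - ((8 : ℕ) : ℤ) : ℤ) : ZMod 5) * t + ((7 : ℕ) : ZMod 5) ≠ 0 := by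
    decide
  haveI := isElliptic_g446400hu1
  haveI := isGloballyMinimal_g446400hu1
  haveI : Fact (Nat.Prime 5) := ⟨by norm_num⟩
  haveI : Fact (Nat.Prime 7) := ⟨by norm_num⟩
  have hI : integralModelInt (⟨0, 0, 0, (-2565000), 1570826250⟩ : WeierstrassCurve ℚ) = (⟨0, 0, 0, (-2565000), 1570826250⟩ : WeierstrassCurve ℤ) :=
    integralModelInt_eq_of_map_eq _ (map_mk_int 0 0 0 (-2565000) 1570826250)
  have hc : Nat.card (((((⟨0, 0, 0, (-2565000), 1570826250⟩ : WeierstrassCurve ℤ))).map (Int.castRingHom (ZMod 7))).toAffine.Point) = 8 := by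
    have h := natCard_point_eq_countPoints 0 0 0 (-2565000) 1570826250 7 (by norm_num) (by decide +kernel)
    have h' : countPoints [0, 0, 0, (-2565000), 1570826250] 7 = 8 := countPoints_eq_of_fast (by decide +kernel)
    exact_mod_cast h.trans h'
  exact hasIrreducibleModPGaloisRep_of_intModel_of_noroot hI 5 7 (by norm_num) (by decide +kernel) hc hnr

/-- **`446400hu1` is ADDITIVE at `5`** (kernel: `5 ∣ Δ`, `5 ∣ c₄` on the minimal model; `Additive.addv_of_intModel`).
[cite: SilvermanAEC2009, VII.5 Prop. 5.1 (c)] [cite: Cremona2006, Table 1 (Cremona label 446400hu1)] -/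
theorem addv_g446400hu1_5 : haveI := isElliptic_g446400hu1; haveI := isGloballyMinimal_g446400hu1; haveI : Fact (Nat.Prime 5) := ⟨by norm_num⟩; Addv (⟨0, 0, 0, (-2565000), 1570826250⟩ : WeierstrassCurve ℚ) 5 := by
  haveI := isElliptic_g446400hu1
  haveI := isGloballyMinimal_g446400hu1
  haveI : Fact (Nat.Prime 5) := ⟨by norm_num⟩
  have hI : integralModelInt (⟨0, 0, 0, (-2565000), 1570826250⟩ : WeierstrassCurve ℚ) = (⟨0, 0, 0, (-2565000), 1570826250⟩ : WeierstrassCurve ℤ) :=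
    integralModelInt_eq_of_map_eq _ (map_mk_int 0 0 0 (-2565000) 1570826250)
  exact Additive.addv_of_intModel hI 5 (by decide +kernel) (by decide +kernel)

/-- **`ord_5 j(E) ≥ 0` for `E = 446400hu1`** (kernel: `5^4 ∣ c₄`, `5^9 ∤ Δ`, `8 ≤ 3·4` on the minimal model; `padicValRat_j_nonneg_of_intModel`) —
potentially good reduction at `5` (`j = 2^16·3^3·5^4·19^3 / 31^5`). [cite: SilvermanAEC2009, VII.5 Prop. 5.5] [cite: Cremona2006, Table 1 (Cremona label 446400hu1)] -/
theorem jint_g446400hu1_5 : haveI := isElliptic_g446400hu1; 0 ≤ padicValRat 5 (⟨0, 0, 0, (-2565000), 1570826250⟩ : WeierstrassCurve ℚ).j := by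
  haveI := isElliptic_g446400hu1
  haveI := isGloballyMinimal_g446400hu1
  haveI : Fact (Nat.Prime 5) := ⟨by norm_num⟩
  have hI : integralModelInt (⟨0, 0, 0, (-2565000), 1570826250⟩ : WeierstrassCurve ℚ) = (⟨0, 0, 0, (-2565000), 1570826250⟩ : WeierstrassCurve ℤ) :=
    integralModelInt_eq_of_map_eq _ (map_mk_int 0 0 0 (-2565000) 1570826250)
  exact TameUpperUnitTwistRecords.padicValRat_j_nonneg_of_intModel hI 5 (a := 4) (b := 8) (by decide +kernel) (by decide +kernel) (by norm_num)

/-- **`446400hu1` lies on the census cell (t′) at `p = 5`** (kernel: `SubTprime` = not potentially multiplicative (`jint_g446400hu1_5`),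
`f_5 = 2` (automatic at an additive `p ≥ 5`), semistability index `e = 12/gcd(12, ord_5 Δ) = 12/gcd(12,8) = 3 ∤ 5 − 1`; `subTprime_of_intModel`).
[cite: SilvermanATAEC1994, IV.10.4] [cite: Delbourgo1998, §1.5] [cite: Cremona2006, Table 1 (Cremona label 446400hu1)] -/
theorem subTprime_g446400hu1_5 : haveI := isElliptic_g446400hu1; haveI := isGloballyMinimal_g446400hu1; haveI : Fact (Nat.Prime 5) := ⟨by norm_num⟩; SubTprime (⟨0, 0, 0, (-2565000), 1570826250⟩ : WeierstrassCurve ℚ) 5 := by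
  haveI := isElliptic_g446400hu1
  haveI := isGloballyMinimal_g446400hu1
  haveI : Fact (Nat.Prime 5) := ⟨by norm_num⟩
  have hI : integralModelInt (⟨0, 0, 0, (-2565000), 1570826250⟩ : WeierstrassCurve ℚ) = (⟨0, 0, 0, (-2565000), 1570826250⟩ : WeierstrassCurve ℤ) :=
    integralModelInt_eq_of_map_eq _ (map_mk_int 0 0 0 (-2565000) 1570826250)
  exact TameUpperUnitTwistRecords.subTprime_of_intModel hI 5 (by norm_num) addv_g446400hu1_5 jint_g446400hu1_5 (b := 8) (by decide +kernel) (by decide +kernel)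
    (by decide)

/-- **(A) at `(446400hu1, 5)` — the conclusion of `TameCoatesSujathaResidue` (19916) / `TameFineSelmerCoatesSujatha` (19413) AT THIS ROW**, by this
seat's one-leaf road (`CoatesSujatha2005.fineSelmerDual_moduleFinite_of_splitCartanIndexTwoBasis_five`, p643448): for every cyclotomic
`ℤ_5`-extension `κ` of `ℚ`, the dual fine Selmer group of `E` over `ℚ_cyc` is finitely generated over `ℤ_5`, from the NAMED FACTS `hCS` (Coates–Sujatha
Thm. 3.4) and `hFW` (Ferrero–Washington), the DISPLAYED image data (`e`; `he`: every `σ` acts through `c·1`, `c·diag(1,4)`, `c·(0 1;2 0)` or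
`c·(0 1;3 0)`; `σ_s ↦ diag(1,4)`, `σ_a ↦ (0 1; 2 0)`) and `μ = 0` for the cyclotomic `ℤ_5`-extension of the ONE fixed field `ℚ(P₁) = ℚ(E[5])^⟨σ̄_s⟩`
(`hμP`; numerically the leaf of the section header, `PASS:IW56`, certified). CONDITIONAL record; (A) is asserted for no curve; nothing booked.
[cite: CoatesSujatha2005, Thm. 3.4 (§3)] [cite: Washington1997, §7.5, §13.1] [cite: Serre1972, §2.2] [cite: Lemmermeyer1994, §1]
[cite: Cremona2006, Table 1 (Cremona label 446400hu1)] -/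
theorem conjA_g446400hu1_5
    (hCS : CoatesSujatha2005.thm34_fineSelmerDual_moduleFinite_of_classicalMuVanishes_divisionField)
    (hFW : ferreroWashington1979_classicalMuVanishes)
    {W : WeierstrassCurve ℚ} [W.IsElliptic] (hWeq : W = (⟨0, 0, 0, (-2565000), 1570826250⟩ : WeierstrassCurve ℚ))
    (e : W.geomTorsion (5 : ℕ) ≃+ (Fin 2 → ZMod 5))
    (he : ∀ σ : absoluteGaloisGroup ℚ, ∃ M ∈ splitCartanNormalizer 5, (M 1 1 = M 0 0 ∨ M 1 1 = 4 * M 0 0) ∧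
      (M 1 0 = 2 * M 0 1 ∨ M 1 0 = 3 * M 0 1) ∧ ∀ P : W.geomTorsion (5 : ℕ), e (σ • P) = M *ᵥ e P)
    (σs σa : absoluteGaloisGroup ℚ) (hσs : ∀ P : W.geomTorsion (5 : ℕ), e (σs • P) = !![1, 0; 0, 4] *ᵥ e P)
    (hσa : ∀ P : W.geomTorsion (5 : ℕ), e (σa • P) = !![0, 1; 2, 0] *ᵥ e P)
    (hμP : ∀ κE : ZpExtension ↥(fixedField (Subgroup.zpowers (absRestrictNormalHom (W.divisionField 5) σs))) 5,
      κE.IsCyclotomic → ClassicalMuVanishes κE)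
    (κ : ZpExtension ℚ 5) (hκ : κ.IsCyclotomic) :
    ∃ (γ : absoluteGaloisGroup ℚ) (Df : W.FineSelmerDualData κ γ),
      Module.Finite ℤ_[5] (RestrictScalars ℤ_[5] (IwasawaAlgebra 5) Df.X) := by
  subst hWeq
  haveI : Fact (Nat.Prime 5) := ⟨by norm_num⟩
  exact CoatesSujatha2005.fineSelmerDual_moduleFinite_of_splitCartanIndexTwoBasis_five hCS hFW _ e he σs σa hσs hσa hμP κ hκ

/-- **RECORD — UPPER half `ord₅ #Ш(E) ≤ ord₅ #Ш(E)_an` for `E = 446400hu1` at `p = 5` BY THE μ-ROAD** (U₀-ns row of KT items 19202 / 19982; the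
FIRST U₀ record of this row — no unit twist certified through census v15, outside the basis shape of the split-Cartan door §3): the (t′) door
`CartanMuRoadDoorsTprimeFive.missingUpperBoundAt_five_tame_of_splitCartanIndexTwoBasis_of_mu` (§4: fine-Selmer port of Kato 14.5 (3) ∘ (A) from the ONE
`μ`-hypothesis by Kuroda's `V₄ = {±1, ±diag(1,4)}` relation up the tower). KERNEL (this file): `Δ ≠ 0`, global minimality (Kraus), `E[5]` irreducible
(Frobenius witness `ℓ = 7`), `Addv E 5`, `ord₅ j ≥ 0`, `SubTprime E 5`. DISPLAYED: the named facts `hKatoA hGZK hmod hCS hFW`; Cremona's `r_an = 0` (`hr`);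
the image data and the `μ`-hypothesis of `conjA_g446400hu1_5`. Per row; CONDITIONAL; nothing booked; BSD is not proved by this.
[cite: Kato2004Asterisque, Thm. 14.5 (3) (p. 236), Thm. 12.5 (3) (p. 222)] [cite: CoatesSujatha2005, Thm. 3.4 (§3)] [cite: Washington1997, §13.1]
[cite: Miller2011LMS, Def. 1.1] [cite: Cremona2006, Table 1 (Cremona label 446400hu1)] -/
theorem missingUpperBoundAt_g446400hu1_5
    (hKatoA : Kato2004.rankZero_padicValNat_sha_add_padicValNat_tamagawa_le_of_additive_potGood_of_irreducible_of_fineSelmerDual_fg)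
    (hGZK : rank_eq_analyticRank_of_analyticRank_le_one) (hmod : hasEntireLFunction_rat)
    (hCS : CoatesSujatha2005.thm34_fineSelmerDual_moduleFinite_of_classicalMuVanishes_divisionField)
    (hFW : ferreroWashington1979_classicalMuVanishes)
    {W : WeierstrassCurve ℚ} [W.IsElliptic] [W.IsGloballyMinimal] (hWeq : W = (⟨0, 0, 0, (-2565000), 1570826250⟩ : WeierstrassCurve ℚ))
    (hr : W.analyticRank = 0)
    (e : W.geomTorsion (5 : ℕ) ≃+ (Fin 2 → ZMod 5))
    (he : ∀ σ : absoluteGaloisGroup ℚ, ∃ M ∈ splitCartanNormalizer 5, (M 1 1 = M 0 0 ∨ M 1 1 = 4 * M 0 0) ∧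
      (M 1 0 = 2 * M 0 1 ∨ M 1 0 = 3 * M 0 1) ∧ ∀ P : W.geomTorsion (5 : ℕ), e (σ • P) = M *ᵥ e P)
    (σs σa : absoluteGaloisGroup ℚ) (hσs : ∀ P : W.geomTorsion (5 : ℕ), e (σs • P) = !![1, 0; 0, 4] *ᵥ e P)
    (hσa : ∀ P : W.geomTorsion (5 : ℕ), e (σa • P) = !![0, 1; 2, 0] *ᵥ e P)
    (hμP : ∀ κE : ZpExtension ↥(fixedField (Subgroup.zpowers (absRestrictNormalHom (W.divisionField 5) σs))) 5,
      κE.IsCyclotomic → ClassicalMuVanishes κE) :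
    MissingUpperBoundAt W 5 := by
  subst hWeq
  haveI : Fact (Nat.Prime 5) := ⟨by norm_num⟩
  exact CartanMuRoadDoorsTprimeFive.missingUpperBoundAt_five_tame_of_splitCartanIndexTwoBasis_of_mu _ hKatoA hGZK hmod hCS hFW hr
    addv_g446400hu1_5 subTprime_g446400hu1_5 irr_g446400hu1_5 e he σs σa hσs hσa hμP

/-! ### APPEND (k8t-c4 g18): the SECOND, IMAGE-FREE road for `446400hu1` @ `5` — Iwasawa 1956 on the WHOLE division field `ℚ(E[5])`
(degree `16`): kit j311361 (`l16clgp.gp` sha16 d3c457da9b959a00, PARI 2.17.3): `ℚ(E[5]) ≅ ℚ[x]/(x¹⁶ − 30x¹⁴ + 540x¹² − 6120x¹⁰ + 44640x⁸ − 194400x⁶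
+ 475200x⁴ − 518400x² + 518400)`, `|d| = 2^24·3^12·5^14` (root discriminant `≈ 26.4`), totally complex, `Cl ≅ ℤ/2 × ℤ/2` (`h = 4`, CERTIFIED by
`bnfcertify`), ONE prime above `5` (`e = 8`, `f = 2`) ⇒ Iwasawa 1956 ⇒ `e_n = 0` for all `n` (consistent with the Kuroda `V₄` count of §4's road:
`v₅ h(ℚ(E[5])) ≤ v₅ h(ℚ(ζ₁₅)) + 2·v₅ h(ℚ(P₁)) = 0`). -/

/-- **RECORD (second road, image-free) — UPPER half `ord₅ #Ш(E) ≤ ord₅ #Ш(E)_an` for `E = 446400hu1` at `p = 5` from TWO CLASS-GROUP INTEGERS of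
`ℚ(E[5])`**: the door `CartanMuRoadDoorsTprimeFive.missingUpperBoundAt_tame_of_not_dvd_classNumber_divisionField_of_unique_prime` (§5: fine-Selmer port
of Kato 14.5 (3) ∘ Coates–Sujatha Thm. 3.4 ∘ Iwasawa 1956 — the last a tree THEOREM). KERNEL (this file): `Δ ≠ 0`, global minimality, `E[5]` irreducible,
`Addv E 5`, `ord₅ j ≥ 0`, `SubTprime E 5`. DISPLAYED: the named facts `hKatoA hGZK hmod hCS` (NO Ferrero–Washington, NO image data, NO `μ`-hypothesis);
Cremona's `r_an = 0` (`hr`); the two integers `5 ∤ h(ℚ(E[5])) = 4` (`hh`) and «one prime above 5» (`hv`) of kit j311361 (certified). Per row; CONDITIONAL;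
nothing booked; BSD is not proved by this. [cite: Kato2004Asterisque, Thm. 14.5 (3) (p. 236), Thm. 12.5 (3) (p. 222)] [cite: CoatesSujatha2005, Thm. 3.4 (§3)]
[cite: Greenberg2001IwasawaPastPresent, Prop. 2.1 p. 339] [cite: Washington1997, Thm. 10.4, Prop. 13.22] [cite: Cremona2006, Table 1 (Cremona label 446400hu1)] -/
theorem missingUpperBoundAt_g446400hu1_5_of_classNumber
    (hKatoA : Kato2004.rankZero_padicValNat_sha_add_padicValNat_tamagawa_le_of_additive_potGood_of_irreducible_of_fineSelmerDual_fg)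
    (hGZK : rank_eq_analyticRank_of_analyticRank_le_one) (hmod : hasEntireLFunction_rat)
    (hCS : CoatesSujatha2005.thm34_fineSelmerDual_moduleFinite_of_classicalMuVanishes_divisionField)
    {W : WeierstrassCurve ℚ} [W.IsElliptic] [W.IsGloballyMinimal] (hWeq : W = (⟨0, 0, 0, (-2565000), 1570826250⟩ : WeierstrassCurve ℚ))
    (hr : W.analyticRank = 0)
    (hh : haveI : NumberField ↥(W.divisionField 5) := NumberField.mk
      ¬ 5 ∣ NumberField.classNumber ↥(W.divisionField 5))
    (hv : haveI : NumberField ↥(W.divisionField 5) := NumberField.mk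
      ∃! v : IsDedekindDomain.HeightOneSpectrum (NumberField.RingOfIntegers ↥(W.divisionField 5)),
        ((5 : ℕ) : NumberField.RingOfIntegers ↥(W.divisionField 5)) ∈ v.asIdeal) :
    MissingUpperBoundAt W 5 := by
  subst hWeq
  haveI : Fact (Nat.Prime 5) := ⟨by norm_num⟩
  exact CartanMuRoadDoorsTprimeFive.missingUpperBoundAt_tame_of_not_dvd_classNumber_divisionField_of_unique_prime _ hKatoA hGZK hmod hCS 5
    hr (by decide) addv_g446400hu1_5 subTprime_g446400hu1_5 irr_g446400hu1_5 hh hv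

end Summit.BirchSwinnertonDyer.BirchSwinnertonDyer.Theorems.TameConjAFiveRecords

end
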